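import Summits.HubbardSuperconductivity.HubbardSuperconductivity.Theorems.WeakCouplingBCSKlLindhardEnclosureGate

/-!
# KL-MARGIN-SCAN reader (22) «kernel-lindhard-enclosure» — RECORDS SOUNDNESS, layer 3a: the integer LOG majorant / minorant

The two curved-cell ceiling rules (majorised hyperbola `ceilBdry`, tip `ceilTip`) integrate `1/(S u + V)` to a logarithm and round it UP
through the kernel's `logUpZ` (Cos §1: dyadic reduction `1 + z = 2^k (1 + w)`, `k = ilog2 …`, `log 2 ≤ L2UP/D`, then the `[2,1]` Padé
majorant `log(1+w) ≤ w(w+6)/(2(2w+3))` = Gate §5 `log_le_pade`); the boundary FLOOR rounds DOWN through `logLoZ` (`2z/(2+z) ≤ log(1+z)`).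
Proved here, for every `Z ≥ 0` (numerators over `D = 2^40`):
`logLoZ Z ≤ D · log (1 + Z/D) ≤ logUpZ Z` (`logLoZ_le`, `le_logUpZ`), with the ingredients `two_pow_ilog2_le` (`2^(ilog2 f m) ≤ max m 1`),
the thirteen-digit bound `D · log 2 ≤ L2UP` (`D·log 2 = 762 123 384 785.81…`, `L2UP = 762 123 384 786`; Mathlib's `Real.log_two_lt_d9` is
too coarse by `3·10⁻¹⁰`, so the bound is taken from the series `log 2 = Σ (1/2)^{n+1}/(n+1)` truncated at 36 terms with the geometric tail
`≤ 2^{-36}/37`), and `two_mul_div_le_log` (`2z/(2+z) ≤ log(1+z)`, `z ≥ 0`).  Honest framing: elementary real analysis about the landed kernel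
definitions; nothing in this file asserts a KL margin at any `t′ ≠ 0`, `K₃`, `U₀`, the window or B1g dominance; a Kohn–Luttinger instability
statement is not ODLRO and nothing here proves superconductivity in the Hubbard model.  (p1 g26, 2026-08-29.)
-/

noncomputable section

set_option linter.dupNamespace false

namespace Summit.HubbardSuperconductivity.HubbardSuperconductivity.Theorems.KlLindhardEnclosure

open Real Set MeasureTheory Finset
open Summit.HubbardSuperconductivity.HubbardSuperconductivity.Theorems

/-! ## §1 `log 2` to thirteen digits: `D · log 2 ≤ L2UP` -/

/-- Series majorant: `log 2 ≤ Σ_{n<36} (1/2)^{n+1}/(n+1) + (1/2)^36/37` (tail of `Σ (1/2)^{n+1}/(n+1)` bounded by the geometric series). -/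
theorem log_two_le_series :
    Real.log 2 ≤ (∑ n ∈ range 36, (1 / 2 : ℝ) ^ (n + 1) / (n + 1)) + (1 / 2 : ℝ) ^ 36 / 37 := by
  have hs := Real.hasSum_pow_div_log_of_abs_lt_one (show |(1 / 2 : ℝ)| < 1 by rw [abs_of_pos (by norm_num)]; norm_num)
  have e : -Real.log (1 - 1 / 2) = Real.log 2 := by
    rw [show (1 : ℝ) - 1 / 2 = 2⁻¹ by norm_num, Real.log_inv, neg_neg]
  rw [e] at hs
  have hsum := hs.summable
  rw [← hs.tsum_eq, ← Summable.sum_add_tsum_nat_add 36 hsum]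
  gcongr
  -- the tail
  have hgeo : Summable fun n : ℕ => (1 / 2 : ℝ) ^ n := summable_geometric_of_lt_one (by norm_num) (by norm_num)
  have hg : Summable fun n : ℕ => (1 / 2 : ℝ) ^ 36 / 37 * (1 / 2 : ℝ) ^ (n + 1) :=
    (hgeo.mul_left ((1 / 2 : ℝ) ^ 36 / 37 * (1 / 2))).congr fun n => by ring
  have hf : Summable fun n : ℕ => (1 / 2 : ℝ) ^ (n + 36 + 1) / ((n + 36 : ℕ) + 1) :=
    (summable_nat_add_iff 36).mpr hsum
  have hle : ∀ n : ℕ, (1 / 2 : ℝ) ^ (n + 36 + 1) / ((n + 36 : ℕ) + 1) ≤ (1 / 2 : ℝ) ^ 36 / 37 * (1 / 2 : ℝ) ^ (n + 1) := by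
    intro n
    have h37 : (37 : ℝ) ≤ ((n + 36 : ℕ) : ℝ) + 1 := by push_cast; linarith [(Nat.cast_nonneg n : (0 : ℝ) ≤ n)]
    have hpos : (0 : ℝ) < ((n + 36 : ℕ) : ℝ) + 1 := by positivity
    rw [div_le_iff₀ hpos, show (1 / 2 : ℝ) ^ (n + 36 + 1) = (1 / 2 : ℝ) ^ 36 * (1 / 2 : ℝ) ^ (n + 1) by ring]
    have : 0 ≤ (1 / 2 : ℝ) ^ 36 * (1 / 2 : ℝ) ^ (n + 1) := by positivity
    calc (1 / 2 : ℝ) ^ 36 * (1 / 2) ^ (n + 1) = (1 / 2 : ℝ) ^ 36 / 37 * (1 / 2) ^ (n + 1) * 37 := by ring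
      _ ≤ (1 / 2 : ℝ) ^ 36 / 37 * (1 / 2) ^ (n + 1) * (((n + 36 : ℕ) : ℝ) + 1) := by gcongr
  refine (Summable.tsum_le_tsum hle hf hg).trans (le_of_eq ?_)
  rw [tsum_mul_left]
  have hgeo1 : ∑' n : ℕ, (1 / 2 : ℝ) ^ (n + 1) = 1 := by
    have h1 : ∑' n : ℕ, (1 / 2 : ℝ) ^ n = 2 := by
      rw [tsum_geometric_of_lt_one (by norm_num) (by norm_num)]; norm_num
    have h2 : ∑' n : ℕ, (1 / 2 : ℝ) ^ (n + 1) = ∑' n : ℕ, (1 / 2 : ℝ) * (1 / 2 : ℝ) ^ n := by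
      congr 1; funext n; rw [pow_succ']
    rw [h2, tsum_mul_left, h1]; norm_num
  rw [hgeo1, mul_one]

/-- **`D · log 2 ≤ L2UP`** (`2^40 · 0.693147180559945… = 762123384785.81… ≤ 762123384786`). -/
theorem D_mul_log_two_le_L2UP : (2 : ℝ) ^ 40 * Real.log 2 ≤ ((L2UP : ℤ) : ℝ) := by
  have h := log_two_le_series
  simp only [sum_range_succ, sum_range_zero] at h
  norm_num at h
  rw [L2UP]
  push_cast
  linarith

/-! ## §2 `ilog2` never overshoots -/

/-- `2^(ilog2 fuel m) ≤ max m 1`. -/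
theorem two_pow_ilog2_le (fuel m : ℕ) : 2 ^ ilog2 fuel m ≤ max m 1 := by
  induction fuel generalizing m with
  | zero => simp [ilog2]
  | succ f ih =>
    simp only [ilog2]
    split_ifs with h
    · simp
    · push Not at h
      have := ih (m / 2)
      have h1 : 1 ≤ m / 2 := (Nat.le_div_iff_mul_le two_pos).mpr (by omega)
      rw [max_eq_left h1] at this
      rw [pow_succ, max_eq_left (by omega : 1 ≤ m)]
      calc 2 ^ ilog2 f (m / 2) * 2 ≤ m / 2 * 2 := Nat.mul_le_mul_right 2 this
        _ ≤ m := Nat.div_mul_le_self m 2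

/-! ## §3 The log minorant `2z/(2+z) ≤ log(1+z)` and `logLoZ` -/

/-- `2z/(2+z) ≤ log(1+z)` for `z ≥ 0` (the defect has derivative `z²/((1+z)(2+z)²) ≥ 0` and vanishes at `0`). -/
theorem two_mul_div_le_log {z : ℝ} (hz : 0 ≤ z) : 2 * z / (2 + z) ≤ Real.log (1 + z) := by
  let h : ℝ → ℝ := fun t => Real.log (1 + t) - 2 * t / (2 + t)
  have hderiv : ∀ t : ℝ, 0 ≤ t → HasDerivAt h (t ^ 2 / ((1 + t) * (2 + t) ^ 2)) t := by
    intro t ht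
    have hne1 : (1 + t) ≠ 0 := by positivity
    have hne2 : (2 + t) ≠ 0 := by positivity
    have h1 : HasDerivAt (fun y : ℝ => Real.log (1 + y)) (1 / (1 + t)) t := ((hasDerivAt_id' t).const_add 1).log hne1
    have h2 : HasDerivAt (fun y : ℝ => 2 * y) (2 * 1) t := (hasDerivAt_id' t).const_mul 2
    have h3 : HasDerivAt (fun y : ℝ => 2 + y) (1 : ℝ) t := (hasDerivAt_id' t).const_add 2
    have hd := h1.sub (h2.div h3 hne2)
    have heq : 1 / (1 + t) - (2 * 1 * (2 + t) - 2 * t * 1) / (2 + t) ^ 2 = t ^ 2 / ((1 + t) * (2 + t) ^ 2) := by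
      field_simp
      ring
    rw [← heq]
    exact hd
  have hmono : MonotoneOn h (Set.Ici 0) := by
    apply monotoneOn_of_hasDerivWithinAt_nonneg (f' := fun t => t ^ 2 / ((1 + t) * (2 + t) ^ 2)) (convex_Ici 0)
    · exact fun t ht => (hderiv t (Set.mem_Ici.mp ht)).continuousAt.continuousWithinAt
    · intro t ht
      rw [interior_Ici] at ht
      exact (hderiv t (le_of_lt (Set.mem_Ioi.mp ht))).hasDerivWithinAt
    · intro t ht
      rw [interior_Ici] at ht
      have : (0 : ℝ) < t := Set.mem_Ioi.mp ht
      positivity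
  have h0 : h 0 = 0 := by simp [h]
  have := hmono (Set.mem_Ici.mpr (le_refl (0 : ℝ))) (Set.mem_Ici.mpr hz) hz
  rw [h0] at this
  change (0 : ℝ) ≤ Real.log (1 + z) - 2 * z / (2 + z) at this
  linarith

/-- **`logLoZ` IS A MINORANT**: for `Z ≥ 0`, `logLoZ Z ≤ 2^40 · log (1 + Z/2^40)`. -/
theorem logLoZ_le {Z : ℤ} (hZ : 0 ≤ Z) : ((logLoZ Z : ℤ) : ℝ) ≤ 2 ^ 40 * Real.log (1 + (Z : ℝ) / 2 ^ 40) := by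
  have hD : (0 : ℤ) < D := by rw [D]; norm_num
  have hden : 0 < 2 * D + Z := by linarith
  have h := fdivZ_le_div (2 * Z * D) (2 * D + Z) hden
  have h' := (Rat.cast_le (K := ℝ)).mpr h
  have hDR : ((D : ℤ) : ℝ) = 2 ^ 40 := by rw [D]; push_cast; norm_num
  simp only [logLoZ] at h' ⊢
  push_cast at h'
  rw [hDR] at h'
  refine h'.trans ?_
  have hZ' : (0 : ℝ) ≤ (Z : ℝ) := by exact_mod_cast hZ
  have hz : (0 : ℝ) ≤ (Z : ℝ) / 2 ^ 40 := by positivity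
  have key := two_mul_div_le_log hz
  have hne : (2 : ℝ) * 2 ^ 40 + (Z : ℝ) ≠ 0 := by positivity
  have e : (2 : ℝ) * (Z : ℝ) * 2 ^ 40 / (2 * 2 ^ 40 + (Z : ℝ)) = 2 ^ 40 * (2 * ((Z : ℝ) / 2 ^ 40) / (2 + (Z : ℝ) / 2 ^ 40)) := by
    rw [div_eq_iff hne]
    field_simp
  rw [e]
  exact mul_le_mul_of_nonneg_left key (by positivity)

/-! ## §4 `logUpZ` is a majorant -/

/-- **`logUpZ` IS A MAJORANT**: for `Z ≥ 0`, `2^40 · log (1 + Z/2^40) ≤ logUpZ Z`. -/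
theorem le_logUpZ {Z : ℤ} (hZ : 0 ≤ Z) : 2 ^ 40 * Real.log (1 + (Z : ℝ) / 2 ^ 40) ≤ ((logUpZ Z : ℤ) : ℝ) := by
  -- names for the kernel's intermediate quantities
  have hD : D = 2 ^ 40 := rfl
  set n : ℤ := D + Z with hn
  have hnpos : 0 < n := by rw [hn, hD]; linarith
  have hnD : D ≤ n := by rw [hn]; linarith
  set m : ℕ := n.toNat / D.toNat with hm
  set k : ℕ := ilog2 128 m with hk
  set w : ℤ := cdivZ n (2 ^ k) - D with hw
  have hlog : logUpZ Z = (k : ℤ) * L2UP + cdivZ (w * (w + 6 * D)) (2 * (2 * w + 3 * D)) := rfl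
  -- (i) 2^k · D ≤ n
  have hDnat : D.toNat = 2 ^ 40 := by rw [hD]; rfl
  have hncast : (n.toNat : ℤ) = n := Int.toNat_of_nonneg hnpos.le
  have hm1 : 1 ≤ m := by
    rw [hm, hDnat]
    apply (Nat.le_div_iff_mul_le (by positivity)).mpr
    have : (2 : ℤ) ^ 40 ≤ (n.toNat : ℤ) := by rw [hncast, ← hD]; exact hnD
    exact_mod_cast this
  have h2k : 2 ^ k ≤ m := by
    have := two_pow_ilog2_le 128 m
    rwa [max_eq_left hm1] at this
  have hmD : (m : ℤ) * D ≤ n := by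
    have h1 : m * D.toNat ≤ n.toNat := by rw [hm]; exact Nat.div_mul_le_self _ _
    have h2 : ((m * D.toNat : ℕ) : ℤ) ≤ (n.toNat : ℤ) := by exact_mod_cast h1
    rw [hncast] at h2
    have h3 : ((D.toNat : ℕ) : ℤ) = D := by rw [hDnat, hD]; norm_num
    push_cast at h2
    rw [h3] at h2
    exact h2
  have h2kD : (2 : ℤ) ^ k * D ≤ n := by
    have : ((2 ^ k : ℕ) : ℤ) ≤ (m : ℤ) := by exact_mod_cast h2k
    push_cast at this
    nlinarith [this, hD]
  -- (ii) w ≥ n/2^k − D ≥ 0 (reals)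
  have h2kpos : (0 : ℤ) < 2 ^ k := by positivity
  have hwge : (n : ℝ) / 2 ^ k - 2 ^ 40 ≤ (w : ℝ) := by
    have h := div_le_cdivZ n (2 ^ k) h2kpos
    have h' := (Rat.cast_le (K := ℝ)).mpr h
    push_cast at h'
    have hDR : ((D : ℤ) : ℝ) = 2 ^ 40 := by rw [D]; push_cast; norm_num
    rw [hw]; push_cast; rw [hDR]; linarith
  have hw0 : (0 : ℝ) ≤ (n : ℝ) / 2 ^ k - 2 ^ 40 := by
    have h1 : (((2 : ℤ) ^ k * D : ℤ) : ℝ) ≤ (n : ℝ) := by exact_mod_cast h2kD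
    have hDR : ((D : ℤ) : ℝ) = 2 ^ 40 := by rw [D]; push_cast; norm_num
    push_cast at h1
    rw [hDR] at h1
    rw [sub_nonneg, le_div_iff₀ (by positivity)]
    linarith
  have hwnn : (0 : ℝ) ≤ (w : ℝ) := hw0.trans hwge
  have hwnnZ : 0 ≤ w := by exact_mod_cast hwnn
  -- (iii) the dyadic decomposition of the logarithm
  have hZn : 1 + (Z : ℝ) / 2 ^ 40 = (n : ℝ) / 2 ^ 40 := by rw [hn]; push_cast [hD]; ring
  have hnR : (0 : ℝ) < (n : ℝ) := by exact_mod_cast hnpos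
  have hsplit : Real.log ((n : ℝ) / 2 ^ 40) = k * Real.log 2 + Real.log (1 + ((n : ℝ) / 2 ^ k - 2 ^ 40) / 2 ^ 40) := by
    have e1 : (n : ℝ) / 2 ^ 40 = 2 ^ k * (1 + ((n : ℝ) / 2 ^ k - 2 ^ 40) / 2 ^ 40) := by
      rw [div_eq_iff (by positivity)]
      field_simp
      ring
    have hpos1 : (0 : ℝ) < 1 + ((n : ℝ) / 2 ^ k - 2 ^ 40) / 2 ^ 40 := by
      have := div_nonneg hw0 (by positivity : (0 : ℝ) ≤ 2 ^ 40); linarith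
    rw [e1, Real.log_mul (by positivity) hpos1.ne', Real.log_pow]
  -- (iv) monotonicity in w and the Padé bound
  have hmono : Real.log (1 + ((n : ℝ) / 2 ^ k - 2 ^ 40) / 2 ^ 40) ≤ Real.log (1 + (w : ℝ) / 2 ^ 40) := by
    apply Real.log_le_log (by positivity)
    gcongr
  have hpade := log_le_pade (z := (w : ℝ) / 2 ^ 40) (by positivity)
  -- (v) the integer rounding of the Padé value
  have hdenP : 0 < 2 * (2 * w + 3 * D) := by rw [hD]; nlinarith
  have rc := div_le_cdivZ (w * (w + 6 * D)) (2 * (2 * w + 3 * D)) hdenP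
  have rc' := (Rat.cast_le (K := ℝ)).mpr rc
  have hDR : ((D : ℤ) : ℝ) = 2 ^ 40 := by rw [D]; push_cast; norm_num
  push_cast at rc'
  rw [hDR] at rc'
  have hPade_eq : 2 ^ 40 * ((w : ℝ) / 2 ^ 40 * ((w : ℝ) / 2 ^ 40 + 6) / (2 * (2 * ((w : ℝ) / 2 ^ 40) + 3)))
      = (w : ℝ) * ((w : ℝ) + 6 * 2 ^ 40) / (2 * (2 * (w : ℝ) + 3 * 2 ^ 40)) := by
    have hne : (2 : ℝ) * (2 * (w : ℝ) + 3 * 2 ^ 40) ≠ 0 := by positivity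
    rw [eq_div_iff hne]
    field_simp
  -- (vi) assemble
  have hL2 := D_mul_log_two_le_L2UP
  rw [hZn, hsplit, hlog]
  push_cast
  have hk0 : (0 : ℝ) ≤ (k : ℝ) := Nat.cast_nonneg k
  have t1 : 2 ^ 40 * ((k : ℝ) * Real.log 2) ≤ (k : ℝ) * ((L2UP : ℤ) : ℝ) := by nlinarith
  have t2 : 2 ^ 40 * Real.log (1 + ((n : ℝ) / 2 ^ k - 2 ^ 40) / 2 ^ 40)
      ≤ ((cdivZ (w * (w + 6 * D)) (2 * (2 * w + 3 * D)) : ℤ) : ℝ) := by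
    have := mul_le_mul_of_nonneg_left (hmono.trans hpade) (by positivity : (0 : ℝ) ≤ 2 ^ 40)
    rw [hPade_eq] at this
    exact this.trans rc'
  linarith

end Summit.HubbardSuperconductivity.HubbardSuperconductivity.Theorems.KlLindhardEnclosure

end
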